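import Literature.Geometry.Riemannian.NashInequalityClosedManifold
import Literature.Geometry.Riemannian.RicciFlowUniformComparison
import Literature.Geometry.Riemannian.BakryEmeryHeatFlow
import Literature.Geometry.Riemannian.PerelmanEntropyCutoff
import HarnessLib

/-!
# Nash's inequality along a Ricci flow, with constants uniform in time

For a Ricci flow `(g, cov)` of Riemannian metrics on `[0, T']` on a closed manifold modelled on
`ℝᵐ`, `m ≥ 3`, Nash's inequality

  `(∫ w² dV_t)^{1+2/m} ≤ (∫ |w| dV_t)^{4/m} · (A ∫ |∇w|²_{g(t)} dV_t + B ∫ w² dV_t)`,  `w ∈ C^∞(M)`,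

holds with constants `A ≥ 1`, `B ≥ 0` INDEPENDENT of `t ∈ [0, T']`
(`IsRicciFlow.exists_uniform_nash_const`): Nash's inequality for the single metric `g(0)`
(`exists_nash_const`, `NashInequalityClosedManifold.lean`, from the Sobolev inequality of a closed
manifold) transferred along the flow by the uniform comparability of `|∇w|²_{g(t)}` with
`|∇w|²_{g(0)}` and of `dV_t` with `dV_0` on the compact time interval
(`RicciFlowUniformComparison.lean`, Topping 2006, Lemma 5.3.2 and (2.5.7)). This is the input of
Nash's `L¹ → L^∞` argument for the heat kernel of the flow. Everything is proved; no definitions,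
no named facts.

## References

* J. Nash, *Continuity of solutions of parabolic and elliptic equations*, Amer. J. Math. 80
  (1958), 931–954.
* P. Topping, *Lectures on the Ricci flow*, LMS Lecture Note Series 325 (2006), Lemma 5.3.2,
  (2.5.7). [Topping2006]
-/

noncomputable section

open Bundle Set Function Filter Manifold MeasureTheory Measure TopologicalSpace Module
open scoped Manifold ContDiff Topology ENNReal NNReal

namespace Literature.Geometry.Riemannian

open Lorentzian Lorentzian.PseudoRiemannianMetric

section UniformNash

variable {m : ℕ} {H : Type*} [TopologicalSpace H]
  {I : ModelWithCorners ℝ (EuclideanSpace ℝ (Fin m)) H} [I.Boundaryless]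
  {M : Type*} [TopologicalSpace M] [ChartedSpace H M] [IsManifold I ∞ M]
  [T2Space M] [CompactSpace M] [MeasurableSpace M] [BorelSpace M]
  {g : ℝ → PseudoRiemannianMetric I ∞ (EuclideanSpace ℝ (Fin m)) (TangentSpace I : M → Type _)}
  {cov : ℝ → CovariantDerivative I (EuclideanSpace ℝ (Fin m)) (TangentSpace I : M → Type _)}

/-- **Nash's inequality along a Ricci flow, uniformly in time.** For a Ricci flow of Riemannian
metrics on `[0, T']`, `T' > 0`, on a closed manifold modelled on `ℝᵐ` with `m ≥ 3` there are
`A ≥ 1`, `B ≥ 0` such that for every `t ∈ [0, T']` and every `w ∈ C^∞(M)`,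
`(∫ w² dV_t)^{1+2/m} ≤ (∫ |w| dV_t)^{4/m} (A ∫ |∇w|²_{g(t)} dV_t + B ∫ w² dV_t)`
(Nash for `g(0)` and uniform comparison of gradients and volumes along the flow).
[cite: Topping2006, Lemma 5.3.2 and (2.5.7)] -/
theorem IsRicciFlow.exists_uniform_nash_const {T' : ℝ} (hT' : 0 < T')
    (hflow : IsRicciFlow g cov (Icc 0 T')) (hR : ∀ t ∈ Icc 0 T', (g t).IsRiemannian)
    (hm : 3 ≤ m) :
    ∃ A B : ℝ, 1 ≤ A ∧ 0 ≤ B ∧ ∀ t ∈ Icc 0 T', ∀ w : M → ℝ, ContMDiff I 𝓘(ℝ, ℝ) ∞ w →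
      (∫ x, w x ^ 2 ∂(g t).riemVolume) ^ (1 + 2 / (m : ℝ)) ≤
        (∫ x, |w x| ∂(g t).riemVolume) ^ (4 / (m : ℝ)) *
          (A * ∫ x, (g t).gradSq w x ∂(g t).riemVolume + B * ∫ x, w x ^ 2 ∂(g t).riemVolume) := by
  have h0 : (0 : ℝ) ∈ Icc 0 T' := ⟨le_rfl, hT'.le⟩
  have hg0 : (g 0).IsRiemannian := hR 0 h0
  have hn : 3 ≤ finrank ℝ (EuclideanSpace ℝ (Fin m)) := by simpa using hm
  obtain ⟨A₀, B₀, hA₀, hB₀, hNash⟩ := exists_nash_const (g 0) hg0 hn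
  simp only [finrank_euclideanSpace_fin] at hNash
  obtain ⟨L, hL, hgrad⟩ := hflow.exists_gradSq_le_mul_gradSq_Icc hT' hR
  obtain ⟨C, hC, hint⟩ := hflow.exists_integral_le_mul_integral_Icc hT' hR
  have hmpos : (0 : ℝ) < m := by exact_mod_cast (show 0 < m by omega)
  have hC0 : 0 ≤ C := zero_le_one.trans hC
  have hL0 : 0 ≤ L := zero_le_one.trans hL
  set e : ℝ := 2 + 6 / (m : ℝ) with he
  have hCe : 1 ≤ C ^ e := Real.one_le_rpow hC (by positivity)
  refine ⟨max (C ^ e * A₀ * L) 1, C ^ e * B₀, le_max_right _ _, by positivity,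
    fun t ht w hw ↦ ?_⟩
  haveI : IsFiniteMeasure (g t).riemVolume := ⟨(g t).riemVolume_univ_lt_top⟩
  haveI : IsFiniteMeasure (g 0).riemVolume := ⟨(g 0).riemVolume_univ_lt_top⟩
  have hgt : (g t).IsRiemannian := hR t ht
  -- the quantities and their comparisons
  have hwc : Continuous w := hw.continuous
  have hw1 : ContMDiff I 𝓘(ℝ, ℝ) 1 w := hw.of_le (by norm_cast)
  have hGc : ∀ s, Continuous ((g s).gradSq w) := fun s ↦ (contMDiff_gradSq (g s) hw).continuous
  have hi : ∀ {f : M → ℝ}, Continuous f → ∀ s, Integrable f (g s).riemVolume := by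
    intro f hf s
    haveI : IsFiniteMeasure (g s).riemVolume := ⟨(g s).riemVolume_univ_lt_top⟩
    exact hf.integrable_of_hasCompactSupport (HasCompactSupport.of_compactSpace _)
  set Et : ℝ := ∫ x, w x ^ 2 ∂(g t).riemVolume with hEt
  set E0 : ℝ := ∫ x, w x ^ 2 ∂(g 0).riemVolume with hE0
  set mt : ℝ := ∫ x, |w x| ∂(g t).riemVolume with hmt
  set m0 : ℝ := ∫ x, |w x| ∂(g 0).riemVolume with hm0
  set Gt : ℝ := ∫ x, (g t).gradSq w x ∂(g t).riemVolume with hGt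
  set G0 : ℝ := ∫ x, (g 0).gradSq w x ∂(g 0).riemVolume with hG0
  have hEt0 : 0 ≤ Et := integral_nonneg fun x ↦ sq_nonneg _
  have hE00 : 0 ≤ E0 := integral_nonneg fun x ↦ sq_nonneg _
  have hmt0 : 0 ≤ mt := integral_nonneg fun x ↦ abs_nonneg _
  have hm00 : 0 ≤ m0 := integral_nonneg fun x ↦ abs_nonneg _
  have hGt0 : 0 ≤ Gt := integral_nonneg fun x ↦ gradSq_nonneg (g t) hgt w x
  have hsqc : Continuous fun x ↦ w x ^ 2 := hwc.pow 2
  -- `E0 ≤ C Et`, `m0 ≤ C mt`, `Et ≤ C E0`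
  have hE0le : E0 ≤ C * Et :=
    (hint t ht _ (fun x ↦ sq_nonneg _) (hi hsqc 0) (hi hsqc t)).2
  have hm0le : m0 ≤ C * mt :=
    (hint t ht _ (fun x ↦ abs_nonneg _) (hi hwc.abs 0) (hi hwc.abs t)).2
  have hEtle : Et ≤ C * E0 :=
    (hint t ht _ (fun x ↦ sq_nonneg _) (hi hsqc 0) (hi hsqc t)).1
  -- `G0 ≤ L C Gt`
  have hG0le : G0 ≤ L * (C * Gt) := by
    have h1 : G0 ≤ ∫ x, L * (g t).gradSq w x ∂(g 0).riemVolume :=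
      integral_mono (hi (hGc 0) 0) ((hi (hGc t) 0).const_mul L) fun x ↦ (hgrad t ht w x).2
    rw [integral_const_mul] at h1
    have h2 := (hint t ht _ (fun x ↦ gradSq_nonneg (g t) hgt w x) (hi (hGc t) 0) (hi (hGc t) t)).2
    exact h1.trans (mul_le_mul_of_nonneg_left h2 hL0)
  -- Nash at time `0`
  have hN := hNash w hw1
  -- assemble
  have hexp1 : 0 ≤ 1 + 2 / (m : ℝ) := by positivity
  have hexp2 : 0 ≤ 4 / (m : ℝ) := by positivity
  calc Et ^ (1 + 2 / (m : ℝ))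
      ≤ (C * E0) ^ (1 + 2 / (m : ℝ)) := Real.rpow_le_rpow hEt0 hEtle hexp1
    _ = C ^ (1 + 2 / (m : ℝ)) * E0 ^ (1 + 2 / (m : ℝ)) := Real.mul_rpow hC0 hE00
    _ ≤ C ^ (1 + 2 / (m : ℝ)) * (m0 ^ (4 / (m : ℝ)) * (A₀ * G0 + B₀ * E0)) :=
        mul_le_mul_of_nonneg_left hN (by positivity)
    _ ≤ C ^ (1 + 2 / (m : ℝ)) * ((C * mt) ^ (4 / (m : ℝ)) *
          (A₀ * (L * (C * Gt)) + B₀ * (C * Et))) := by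
        have hG00 : 0 ≤ G0 := integral_nonneg fun x ↦ gradSq_nonneg (g 0) hg0 w x
        refine mul_le_mul_of_nonneg_left ?_ (by positivity)
        refine mul_le_mul (Real.rpow_le_rpow hm00 hm0le hexp2) ?_ (by positivity) (by positivity)
        gcongr
    _ = mt ^ (4 / (m : ℝ)) * ((C ^ (1 + 2 / (m : ℝ)) * C ^ (4 / (m : ℝ)) * C) *
          (A₀ * L * Gt + B₀ * Et)) := by
        rw [Real.mul_rpow hC0 hmt0]; ring
    _ = mt ^ (4 / (m : ℝ)) * (C ^ e * (A₀ * L * Gt + B₀ * Et)) := by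
        congr 2
        rw [← Real.rpow_add_of_nonneg hC0 hexp1 hexp2, ← Real.rpow_add_one' hC0 ?_, he]
        · congr 1; ring
        · positivity
    _ = mt ^ (4 / (m : ℝ)) * (C ^ e * A₀ * L * Gt + C ^ e * B₀ * Et) := by ring
    _ ≤ mt ^ (4 / (m : ℝ)) * (max (C ^ e * A₀ * L) 1 * Gt + C ^ e * B₀ * Et) := by
        gcongr
        exact le_max_left _ _

end UniformNash

end Literature.Geometry.Riemannian

end
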